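import Literature.NumberTheory.QuadraticFields.IdealClassEpsteinSum
import Mathlib.Analysis.Complex.Exponential
import HarnessLib

/-!
# The form–ideal dictionary for an arbitrary weight: `Σ_{[𝔞] = [𝔟]⁻¹} f(N𝔞) = ½ Σ_{(x,y)} f(Q(x,y))`,
# and the class theta series `θ_𝒜(z) = ½ + Σ_{𝔞 ∈ 𝒜} e(zN𝔞)` as a binary theta series

Topic `NumberTheory/QuadraticFields`, namespace `Literature.NumberTheory.QuadraticFields.Quadratic`
(continuing `IdealClassEpsteinSum.lean`, whose `tsum_ideal_mul_isPrincipal_eq_half_twistZeta` is the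
same identity for the special weight `ψ(N𝔞)N𝔞^{−s}`). Everything here is PROVED (theorems only, no
definitions, no named facts).

Let `K` be an imaginary quadratic field with `d_K < −4` (so `w_K = 2`), `(1, ω)` an integral basis
with `ω² = m + tω` (`d_K = t² + 4m`), and `𝔟 = (A, ω − k)` the lattice ideal `ℤA ⊕ ℤ(ω − k)` of a
form of discriminant `d_K` (`A > 0`, `AC = k² − tk − m`, `FormIdeals.lean`). Write
`Q(x,y) = Ax² + (t − 2k)xy + Cy²` (positive definite). We prove:

* `hasSum_ideal_mul_isPrincipal_weight` — **the class-sum identity for an arbitrary weight**: for any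
  `f : ℕ → ℂ` with `f 0 = 0` and `Σ_{(x,y) ∈ ℤ²} |f(Q(x,y))| < ∞`,
  `Σ_{𝔞 : 𝔟𝔞 principal} f(N𝔞) = ½ Σ_{(x,y) ∈ ℤ²} f(Q(x,y))` (as a `HasSum` over the ideals `𝔞` with
  `𝔟𝔞` principal — the integral ideals of the class `[𝔟]⁻¹` together with `𝔞 = 0`, which contributes
  `f 0 = 0`); `tsum_ideal_mul_isPrincipal_eq_half_tsum`, `hasSum_indicator_ideal_mul_isPrincipal_weight`
  are the `tsum` and the all-ideals-indicator forms. The proof is that of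
  `tsum_ideal_mul_isPrincipal_eq_half_twistZeta` with the weight abstracted: `(x, y) ↦ α = xA + y(ω − k)`
  is a bijection `ℤ² ≅ 𝔟`; `α ↦ 𝔞 = (α)𝔟⁻¹` is two-to-one off `0` (units `±1`) onto the ideals `𝔞`
  with `𝔟𝔞` principal, and `N𝔞 = N(α)/N𝔟 = Q(x, y)`.
* `summable_cexp_mul_bqf` — for `A > 0`, `B² − 4AC < 0` and `Im τ > 0` the binary theta series
  `Σ_{(x,y)} e(τ Q(x,y))`, `Q = (A, B, C)`, converges absolutely (`e^{−λQ} ≤ 2λ^{−2}Q^{−2}` and the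
  tree's `summable_norm_epsteinTerm`).
* `half_add_tsum_ideal_cexp_eq_half_tsum_lattice` — **the class theta series is a binary theta
  series**: for `Im τ > 0`,
  `½ + Σ_{𝔞 ≠ 0 : 𝔟𝔞 principal} e(τ N𝔞) = ½ Σ_{(x,y) ∈ ℤ²} e(τ Q(x,y))`,
  i.e. Conrey–Iwaniec's (2.14) `θ_𝒜(z) = ½ + Σ_{𝔞 ∈ 𝒜} e(zN𝔞)` for the class `𝒜 = [𝔟]⁻¹` is one half of
  the theta series of the form `Q` (`w = 2`). This is the entry point of the binary-theta-series
  treatment of the class-group theta functions `θ(z;ψ) = Σ_𝒜 ψ(𝒜)θ_𝒜(z)` ((2.16)–(2.17)).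

This is the classical statement "the number of integral ideals of norm `n` in a class is `1/w` times
the number of representations of `n` by the corresponding form" (Cox, *Primes of the form
x² + ny²*, Thm. 7.7; Zagier, *Zetafunktionen und quadratische Körper*, §8) in summed form, for
every summable weight at once. Mathlib has `ClassGroup`, `Ideal.absNorm`; the dictionary is the
tree's (`FormIdeals`, `LatticeSumPrincipal`, `IdealClassEpsteinSum`).

## References

* [Cox2013] D. A. Cox, *Primes of the form x² + ny²*, 2nd ed. (2013), §7.B Thm. 7.7.
* [Zagier1981] D. B. Zagier, *Zetafunktionen und quadratische Körper* (1981), §8.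
* [ConreyIwaniec2002] B. Conrey, H. Iwaniec, Acta Arith. 103 (2002) 259–312, §2 (2.14)–(2.17).
-/

noncomputable section

open Module NumberField Ideal Complex
open Literature.Barriers.RiemannHypothesis

namespace Literature.NumberTheory.QuadraticFields.Quadratic

variable {K : Type*} [Field K] [NumberField K]

/-! ### The class-sum identity for an arbitrary weight -/

/-- **The class-sum identity for an arbitrary weight**: with `𝔟 = (A, ω − k)`, `A > 0`,
`AC = k² − tk − m`, `d_K = t² + 4m < −4`, and any `f : ℕ → ℂ` with `f 0 = 0` and
`Σ_{(x,y)} |f(Q(x,y))| < ∞`, `Q = (A, t − 2k, C)`: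
`Σ_{𝔞 : 𝔟𝔞 principal} f(N𝔞) = ½ Σ_{(x,y) ∈ ℤ²} f(Q(x, y))`.
The ideals `𝔞 ≠ 0` with `𝔟𝔞` principal are the integral ideals of the class `[𝔟]⁻¹`; `𝔞 = 0`
contributes `f 0 = 0` on the left and `(x,y) = 0` contributes `f 0 = 0` on the right. Proof:
`(x, y) ↦ α = xA + y(ω − k)` is a bijection `ℤ² ≅ 𝔟`, `α ↦ 𝔞` with `(α) = 𝔟𝔞` is two-to-one off `0`
(`(α) = (α') ⇔ α' = ±α`), and `N𝔞 = N(α)/N𝔟 = Q(x, y)` (`norm_lattice_elt`, `absNorm_span_pair_eq`).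
Cox, Thm. 7.7; Zagier §8 "`ζ(s, A) = (1/w) Σ'_{x,y} Q(x,y)^{−s}`" is the case `f(n) = n^{−s}`.
[cite: Cox2013, §7.B Thm. 7.7] -/
theorem hasSum_ideal_mul_isPrincipal_weight (b : Basis (Fin 2) ℤ (𝓞 K)) (hb : b 0 = 1)
    {t m : ℤ} (hω : b 1 * b 1 = (m : 𝓞 K) + (t : 𝓞 K) * b 1) (hD : t ^ 2 + 4 * m < -4)
    {A k C : ℤ} (hA : 0 < A) (hn : A * C = k ^ 2 - t * k - m)
    {f : ℕ → ℂ} (hf0 : f 0 = 0)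
    (hf : Summable fun p : ℤ × ℤ =>
      f (A * p.1 ^ 2 + (t - 2 * k) * p.1 * p.2 + C * p.2 ^ 2).natAbs) :
    HasSum (fun J : {J : Ideal (𝓞 K) // (span {(A : 𝓞 K), b 1 - k} * J).IsPrincipal} =>
        f (absNorm J.1))
      (1 / 2 * ∑' p : ℤ × ℤ, f (A * p.1 ^ 2 + (t - 2 * k) * p.1 * p.2 + C * p.2 ^ 2).natAbs) := by
  classical
  set 𝔟 : Ideal (𝓞 K) := span {(A : 𝓞 K), b 1 - k} with h𝔟
  have h𝔟0 : 𝔟 ≠ 0 := by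
    intro h0
    have hmem : (A : 𝓞 K) ∈ 𝔟 := Ideal.subset_span (by simp)
    rw [h0] at hmem
    have h1 : (A : 𝓞 K) = 0 := by simpa using hmem
    exact hA.ne' (intCast_eq_zero_of_basis b hb h1)
  -- (1) the lattice bijection `ℤ² ≃ 𝔟`
  set φ : ℤ × ℤ → 𝔟 := fun p => ⟨(p.1 : 𝓞 K) * A + (p.2 : 𝓞 K) * (b 1 - k),
    (mem_span_pair_iff_of_basis b hb hω hn _).2 ⟨p.1, p.2, rfl⟩⟩ with hφ
  have hφ_bij : Function.Bijective φ := by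
    constructor
    · intro p q hpq
      have h := congrArg Subtype.val hpq
      simp only [hφ] at h
      obtain ⟨h1, h2⟩ := lattice_coords_unique b hb hA.ne' h
      exact Prod.ext h1 h2
    · rintro ⟨x, hx⟩
      obtain ⟨u, v, rfl⟩ := (mem_span_pair_iff_of_basis b hb hω hn x).1 hx
      exact ⟨(u, v), rfl⟩
  set e : ℤ × ℤ ≃ 𝔟 := Equiv.ofBijective φ hφ_bij with he
  have he_apply : ∀ p : ℤ × ℤ, ((e p : 𝔟) : 𝓞 K) = (p.1 : 𝓞 K) * A + (p.2 : 𝓞 K) * (b 1 - k) :=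
    fun p => rfl
  -- (2) the cofactor ideal `J(α)`: `(α) = 𝔟 · J(α)`
  have hdvd : ∀ α : 𝔟, 𝔟 ∣ span {(α : 𝓞 K)} := fun α =>
    Ideal.dvd_iff_le.mpr ((Ideal.span_singleton_le_iff_mem _).mpr α.2)
  set Jof : 𝔟 → Ideal (𝓞 K) := fun α => Classical.choose (hdvd α) with hJof
  have hJof_spec : ∀ α : 𝔟, span {(α : 𝓞 K)} = 𝔟 * Jof α := fun α => Classical.choose_spec (hdvd α)
  have hJof_uniq : ∀ (α : 𝔟) (J : Ideal (𝓞 K)), span {(α : 𝓞 K)} = 𝔟 * J → J = Jof α := by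
    intro α J hJ
    have : 𝔟 * J = 𝔟 * Jof α := hJ.symm.trans (hJof_spec α)
    exact mul_left_cancel₀ h𝔟0 this
  -- `J(α) = J(α') ↔ α' = ±α`
  have hJof_eq_iff : ∀ α α' : 𝔟, Jof α = Jof α' ↔ (α' = α ∨ α' = -α) := by
    intro α α'
    constructor
    · intro h
      have this : span {(α : 𝓞 K)} = span {(α' : 𝓞 K)} := by rw [hJof_spec α, hJof_spec α', h]
      rcases (span_singleton_eq_span_singleton_iff' b hb hω hD _ _).1 this with h' | h'
      · exact Or.inl (Subtype.ext h')
      · refine Or.inr (Subtype.ext ?_)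
        rw [Submodule.coe_neg]
        exact h'
    · rintro (rfl | rfl)
      · rfl
      · refine hJof_uniq (-α) (Jof α) ?_
        rw [Submodule.coe_neg, Ideal.span_singleton_neg]
        exact hJof_spec α
  -- the norm of `J(e p)` is `|Q(p)| = Q(p)`
  have h𝔟N : absNorm 𝔟 = A.natAbs := absNorm_span_pair_eq b hb hω hn
  have hnormJ : ∀ p : ℤ × ℤ, absNorm (Jof (e p)) =
      (A * p.1 ^ 2 + (t - 2 * k) * p.1 * p.2 + C * p.2 ^ 2).natAbs := by
    intro p
    have h1 := congrArg absNorm (hJof_spec (e p))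
    rw [map_mul, Ideal.absNorm_span_singleton, he_apply, norm_lattice_elt b hb hω hn, h𝔟N,
      Int.natAbs_mul] at h1
    exact (Nat.eq_of_mul_eq_mul_left (Int.natAbs_pos.mpr hA.ne') h1).symm
  -- (3) the summand along `e`
  set G : Ideal (𝓞 K) → ℂ := fun I => f (absNorm I) with hG
  set F : 𝔟 → ℂ := fun α => G (Jof α) with hF
  have hG_bot : G ⊥ = 0 := by
    simp only [hG, Ideal.absNorm_bot, hf0]
  have hterm : ∀ p : ℤ × ℤ,
      f (A * p.1 ^ 2 + (t - 2 * k) * p.1 * p.2 + C * p.2 ^ 2).natAbs = F (e p) := by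
    intro p
    simp only [hF, hG, hnormJ]
  -- (4) the lattice sum is `Σ_α F(α)`
  have hsumF : Summable F := (e.summable_iff).mp (hf.congr hterm)
  have hZ : (∑' p : ℤ × ℤ, f (A * p.1 ^ 2 + (t - 2 * k) * p.1 * p.2 + C * p.2 ^ 2).natAbs) =
      ∑' α : 𝔟, F α := by
    rw [← e.tsum_eq F]
    exact tsum_congr hterm
  -- (5) the fibres of `J`: `{±α₀}` over the ideals `I` with `𝔟I` principal, `∅` otherwise
  have hfib := hsumF.hasSum.tsum_fiberwise Jof
  have hinner : ∀ I : Ideal (𝓞 K), (∑' α : ↥(Jof ⁻¹' {I}), F α) =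
      Set.indicator {I | (𝔟 * I).IsPrincipal} (fun I => 2 * G I) I := by
    intro I
    by_cases hI : (𝔟 * I).IsPrincipal
    · rw [Set.indicator_of_mem (show I ∈ {I | (𝔟 * I).IsPrincipal} from hI)]
      -- a generator `β` of `𝔟I`, as an element `α₀ ∈ 𝔟`
      obtain ⟨β, hβ⟩ : ∃ β : 𝓞 K, 𝔟 * I = span {β} := ⟨_, hI.span_singleton_generator.symm⟩
      have hβmem : β ∈ 𝔟 := by
        have : β ∈ 𝔟 * I := by rw [hβ]; exact Ideal.mem_span_singleton_self β
        exact Ideal.mul_le_right this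
      set α₀ : 𝔟 := ⟨β, hβmem⟩ with hα₀
      have hJα₀ : Jof α₀ = I := (hJof_uniq α₀ I hβ.symm).symm
      have hset : (Jof ⁻¹' {I}) = {α₀, -α₀} := by
        ext α
        simp only [Set.mem_preimage, Set.mem_singleton_iff, Set.mem_insert_iff]
        rw [← hJα₀, eq_comm, hJof_eq_iff α₀ α]
      rw [tsum_subtype (Jof ⁻¹' {I}) F, hset]
      by_cases hβ0 : β = 0
      · -- `𝔟I = 0`, so `I = 0` and the fibre is `{0}`
        have hI0 : I = ⊥ := by
          have : 𝔟 * I = ⊥ := by rw [hβ, hβ0]; simp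
          exact (Ideal.mul_eq_bot.mp this).resolve_left h𝔟0
        have hα00 : α₀ = 0 := Subtype.ext hβ0
        rw [hα00, neg_zero, Set.pair_eq_singleton, tsum_eq_single 0 (fun α hα =>
          Set.indicator_of_notMem (by simpa using hα) F), Set.indicator_of_mem (Set.mem_singleton _)]
        rw [← hα00]
        show G (Jof α₀) = 2 * G I
        rw [hJα₀, hI0, hG_bot, mul_zero]
      · have hne : α₀ ≠ -α₀ := by
          intro h
          have h' : (β : 𝓞 K) = -β := congrArg Subtype.val h
          have : (2 : 𝓞 K) * β = 0 := by linear_combination h'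
          exact hβ0 ((mul_eq_zero.mp this).resolve_left (by norm_num))
        rw [tsum_eq_sum (s := {α₀, -α₀}) (fun α hα => Set.indicator_of_notMem (by simpa using hα) F),
          Finset.sum_pair hne, Set.indicator_of_mem (by simp), Set.indicator_of_mem (by simp)]
        have hJneg : Jof (-α₀) = I := by
          rw [← (hJof_eq_iff α₀ (-α₀)).2 (Or.inr rfl)]
          exact hJα₀
        have h1 : F α₀ = G I := by
          show G (Jof α₀) = G I
          rw [hJα₀]
        have h2 : F (-α₀) = G I := by
          show G (Jof (-α₀)) = G I
          rw [hJneg]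
        rw [h1, h2]
        ring
    · rw [Set.indicator_of_notMem (show I ∉ {I | (𝔟 * I).IsPrincipal} from hI)]
      have hempty : (Jof ⁻¹' {I}) = ∅ := by
        ext α
        simp only [Set.mem_preimage, Set.mem_singleton_iff, Set.mem_empty_iff_false, iff_false]
        intro h
        apply hI
        rw [← h, ← hJof_spec α]
        exact ⟨⟨α, rfl⟩⟩
      rw [tsum_subtype (Jof ⁻¹' {I}) F, hempty]
      simp
  have hfib' : HasSum (Set.indicator {I | (𝔟 * I).IsPrincipal} (fun I => 2 * G I))
      (∑' α : 𝔟, F α) := by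
    have hfun : (fun I : Ideal (𝓞 K) => ∑' α : ↥(Jof ⁻¹' {I}), F α) =
        Set.indicator {I | (𝔟 * I).IsPrincipal} (fun I => 2 * G I) := funext hinner
    rw [← hfun]
    exact hfib
  -- (6) pass to the subtype and divide by `2`
  have hsub : HasSum (fun J : {J : Ideal (𝓞 K) // (𝔟 * J).IsPrincipal} => 2 * G J.1)
      (∑' α : 𝔟, F α) :=
    (hasSum_subtype_iff_indicator (f := fun I : Ideal (𝓞 K) => 2 * G I)
      (s := {I | (𝔟 * I).IsPrincipal})).mpr hfib'
  have h2 := hsub.mul_left (1 / 2 : ℂ)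
  have hfun : (fun J : {J : Ideal (𝓞 K) // (𝔟 * J).IsPrincipal} => (1 / 2 : ℂ) * (2 * G J.1)) =
      fun J => G J.1 := by
    funext J
    ring
  rw [hfun, ← hZ] at h2
  exact h2

/-- **The class-sum identity for an arbitrary weight, `tsum` form**:
`Σ'_{𝔞 : 𝔟𝔞 principal} f(N𝔞) = ½ Σ'_{(x,y) ∈ ℤ²} f(Q(x, y))` (hypotheses as in
`hasSum_ideal_mul_isPrincipal_weight`). [cite: Cox2013, §7.B Thm. 7.7] -/
theorem tsum_ideal_mul_isPrincipal_eq_half_tsum (b : Basis (Fin 2) ℤ (𝓞 K)) (hb : b 0 = 1)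
    {t m : ℤ} (hω : b 1 * b 1 = (m : 𝓞 K) + (t : 𝓞 K) * b 1) (hD : t ^ 2 + 4 * m < -4)
    {A k C : ℤ} (hA : 0 < A) (hn : A * C = k ^ 2 - t * k - m)
    {f : ℕ → ℂ} (hf0 : f 0 = 0)
    (hf : Summable fun p : ℤ × ℤ =>
      f (A * p.1 ^ 2 + (t - 2 * k) * p.1 * p.2 + C * p.2 ^ 2).natAbs) :
    ∑' J : {J : Ideal (𝓞 K) // (span {(A : 𝓞 K), b 1 - k} * J).IsPrincipal}, f (absNorm J.1) =
      1 / 2 * ∑' p : ℤ × ℤ, f (A * p.1 ^ 2 + (t - 2 * k) * p.1 * p.2 + C * p.2 ^ 2).natAbs :=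
  (hasSum_ideal_mul_isPrincipal_weight b hb hω hD hA hn hf0 hf).tsum_eq

/-- **The class-sum identity for an arbitrary weight, as a sum over all ideals** (the terms outside
the class `[𝔟]⁻¹` set to `0`): `Σ_𝔞 𝟙[𝔟𝔞 principal] f(N𝔞) = ½ Σ_{(x,y) ∈ ℤ²} f(Q(x, y))`.
This is the form in which the class sums are reassembled over the class group.
[cite: Cox2013, §7.B Thm. 7.7] -/
theorem hasSum_indicator_ideal_mul_isPrincipal_weight (b : Basis (Fin 2) ℤ (𝓞 K)) (hb : b 0 = 1)
    {t m : ℤ} (hω : b 1 * b 1 = (m : 𝓞 K) + (t : 𝓞 K) * b 1) (hD : t ^ 2 + 4 * m < -4)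
    {A k C : ℤ} (hA : 0 < A) (hn : A * C = k ^ 2 - t * k - m)
    {f : ℕ → ℂ} (hf0 : f 0 = 0)
    (hf : Summable fun p : ℤ × ℤ =>
      f (A * p.1 ^ 2 + (t - 2 * k) * p.1 * p.2 + C * p.2 ^ 2).natAbs) :
    HasSum (Set.indicator {J : Ideal (𝓞 K) | (span {(A : 𝓞 K), b 1 - k} * J).IsPrincipal}
        (fun J => f (absNorm J)))
      (1 / 2 * ∑' p : ℤ × ℤ, f (A * p.1 ^ 2 + (t - 2 * k) * p.1 * p.2 + C * p.2 ^ 2).natAbs) :=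
  (hasSum_subtype_iff_indicator (f := fun J : Ideal (𝓞 K) => f (absNorm J))
    (s := {J : Ideal (𝓞 K) | (span {(A : 𝓞 K), b 1 - k} * J).IsPrincipal})).mp
    (hasSum_ideal_mul_isPrincipal_weight b hb hω hD hA hn hf0 hf)

/-! ### Binary theta series: absolute convergence -/

/-- The exponent of a term of a binary theta series: `Re(2πi τ n) = −2π (Im τ) n` for an
integer `n` (private computational helper). [folklore] -/
private theorem re_two_pi_I_mul_mul_intCast (τ : ℂ) (n : ℤ) :
    (2 * Real.pi * I * τ * (n : ℂ)).re = -(2 * Real.pi * τ.im * n) := by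
  simp [Complex.mul_re, Complex.mul_im, mul_comm]

/-- **Absolute convergence of the theta series of a positive definite binary quadratic form**
(the series (2.15) of Conrey–Iwaniec, `θ_𝒜(z) = ½ Σ_m Σ_n e(zφ_𝒜(m,n))`, "`a > 0`, `b² − 4ac = −q`"):
for `A > 0`, `B² − 4AC < 0` and `Im τ > 0`, `Σ_{(x,y) ∈ ℤ²} |e(τ(Ax² + Bxy + Cy²))| < ∞`
(`|e(τQ)| = e^{−2π(Im τ)Q} ≤ 2(2π Im τ)^{−2}Q^{−2}` off the origin, and `Σ' Q^{−2} < ∞` by the tree's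
`summable_norm_epsteinTerm`). [cite: ConreyIwaniec2002, §2 (2.15)] -/
theorem summable_cexp_mul_bqf {A B C : ℤ} (hA : 0 < A) (hdisc : B ^ 2 - 4 * A * C < 0)
    {τ : ℂ} (hτ : 0 < τ.im) :
    Summable fun p : ℤ × ℤ =>
      cexp (2 * Real.pi * I * τ * ((A * p.1 ^ 2 + B * p.1 * p.2 + C * p.2 ^ 2 : ℤ) : ℂ)) := by
  have hpos : IsPosDefForm (A : ℝ) (B : ℝ) (C : ℝ) :=
    ⟨by exact_mod_cast hA, by exact_mod_cast hdisc⟩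
  have h2 : (1 : ℝ) < (2 : ℂ).re := by norm_num
  set lam : ℝ := 2 * Real.pi * τ.im with hlam
  have hlam0 : 0 < lam := by positivity
  have hmaj : Summable fun p : ℤ × ℤ => 2 / lam ^ 2 * ‖epsteinTerm (A : ℝ) (B : ℝ) (C : ℝ) 2 p‖ :=
    (summable_norm_epsteinTerm hpos h2).mul_left _
  refine Summable.of_norm_bounded_eventually hmaj
    ((Filter.eventually_cofinite_ne (0 : ℤ × ℤ)).mono fun p hp => ?_)
  have hQ : 0 < bqfEval (A : ℝ) (B : ℝ) (C : ℝ) p := hpos.eval_pos hp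
  have hQeq : bqfEval (A : ℝ) (B : ℝ) (C : ℝ) p =
      ((A * p.1 ^ 2 + B * p.1 * p.2 + C * p.2 ^ 2 : ℤ) : ℝ) := by
    unfold bqfEval; push_cast; ring
  rw [Complex.norm_exp, re_two_pi_I_mul_mul_intCast, ← hQeq, epsteinTerm, if_neg hp]
  rw [Complex.norm_cpow_eq_rpow_re_of_pos hQ, Complex.neg_re,
    show (2 : ℂ).re = (2 : ℝ) by norm_num, Real.rpow_neg hQ.le, Real.rpow_two]
  -- `e^{−λQ} ≤ 2 λ^{−2} Q^{−2}` from `(λQ)²/2 ≤ e^{λQ}`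
  set X : ℝ := bqfEval (A : ℝ) (B : ℝ) (C : ℝ) p with hX
  have hx : 0 ≤ lam * X := by positivity
  have hexp := Real.pow_div_factorial_le_exp _ hx 2
  rw [Nat.factorial_two, Nat.cast_ofNat] at hexp
  have hexp_pos : 0 < Real.exp (lam * X) := Real.exp_pos _
  have hlQ : 0 < lam * X := by positivity
  rw [show -(2 * Real.pi * τ.im * X) = -(lam * X) by rw [hlam], Real.exp_neg,
    inv_le_iff_one_le_mul₀ hexp_pos]
  calc (1 : ℝ) = ((lam * X) ^ 2 / 2) * (2 / lam ^ 2 * (X ^ 2)⁻¹) := by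
        field_simp
    _ ≤ Real.exp (lam * X) * (2 / lam ^ 2 * (X ^ 2)⁻¹) :=
        mul_le_mul_of_nonneg_right hexp (by positivity)
    _ = 2 / lam ^ 2 * (X ^ 2)⁻¹ * Real.exp (lam * X) := mul_comm _ _

/-! ### The class theta series as a binary theta series -/

/-- **`θ_𝒜(z) = ½ + Σ_{𝔞 ∈ 𝒜} e(zN𝔞)` is one half of a binary theta series**: with `𝔟 = (A, ω − k)`
as above (`d_K = t² + 4m < −4`, so `w_K = 2`), `Q = (A, t − 2k, C)` and `Im τ > 0`,
`½ + Σ_{𝔞 ≠ 0 : 𝔟𝔞 principal} e(τN𝔞) = ½ Σ_{(x,y) ∈ ℤ²} e(τQ(x,y))`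
— Conrey–Iwaniec (2.14)–(2.15) for the class `𝒜 = [𝔟]⁻¹`: "`θ_𝒜(z) = ½ + Σ_{𝔞∈𝒜} e(zN𝔞)` (2.14)
… (the number 2 stands for the number of units) … This theta function is also given by
`θ_𝒜(z) = ½ Σ_m Σ_n e(zφ_𝒜(m,n))` (2.15) where `φ_𝒜(x,y) = ax² + bxy + cy²` is the corresponding
quadratic form, `a > 0`, `b² − 4ac = −q`, `𝔞 = aℤ + ((b + i√q)/2)ℤ`" (here `𝔟 = Aℤ + ((t − 2k + i√q)/2)ℤ`,
`φ = Q`; the theta series of a class and of its inverse coincide, `N𝔞̄ = N𝔞`). The origin gives the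
constant term `½`; every other value `Q(x,y) = n` is taken by exactly `2 · #{𝔞 ∈ 𝒜 : N𝔞 = n}` lattice
points. The sum on the left runs over all `𝔞` with `𝔟𝔞` principal, the term `𝔞 = 0` being set to `0`.
[cite: ConreyIwaniec2002, §2 (2.14)–(2.15)] -/
theorem half_add_tsum_ideal_cexp_eq_half_tsum_lattice (b : Basis (Fin 2) ℤ (𝓞 K)) (hb : b 0 = 1)
    {t m : ℤ} (hω : b 1 * b 1 = (m : 𝓞 K) + (t : 𝓞 K) * b 1) (hD : t ^ 2 + 4 * m < -4)
    {A k C : ℤ} (hA : 0 < A) (hn : A * C = k ^ 2 - t * k - m) {τ : ℂ} (hτ : 0 < τ.im) :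
    HasSum (fun J : {J : Ideal (𝓞 K) // (span {(A : 𝓞 K), b 1 - k} * J).IsPrincipal} =>
        if (J.1 : Ideal (𝓞 K)) = ⊥ then 0 else cexp (2 * Real.pi * I * τ * (absNorm J.1 : ℂ)))
      (1 / 2 * (∑' p : ℤ × ℤ, cexp (2 * Real.pi * I * τ *
          ((A * p.1 ^ 2 + (t - 2 * k) * p.1 * p.2 + C * p.2 ^ 2 : ℤ) : ℂ))) - 1 / 2) := by
  classical
  -- the weight `f(n) = e(τ n)` for `n ≥ 1`, `f(0) = 0`
  set f : ℕ → ℂ := fun n => if n = 0 then 0 else cexp (2 * Real.pi * I * τ * (n : ℂ)) with hf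
  have hf0 : f 0 = 0 := by simp [hf]
  -- discriminant of `Q = (A, t − 2k, C)` is `t² + 4m < 0`
  have hdisc : (t - 2 * k) ^ 2 - 4 * A * C < 0 := by nlinarith [hn, hD]
  have hpos : IsPosDefForm (A : ℝ) ((t - 2 * k : ℤ) : ℝ) (C : ℝ) :=
    ⟨by exact_mod_cast hA, by exact_mod_cast hdisc⟩
  set g : ℤ × ℤ → ℂ := fun p => cexp (2 * Real.pi * I * τ *
      ((A * p.1 ^ 2 + (t - 2 * k) * p.1 * p.2 + C * p.2 ^ 2 : ℤ) : ℂ)) with hg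
  have hgsum : Summable g := summable_cexp_mul_bqf hA hdisc hτ
  -- `f(Q(p)) = g(p)` off the origin, `= 0` at the origin
  have hfg : ∀ p : ℤ × ℤ,
      f (A * p.1 ^ 2 + (t - 2 * k) * p.1 * p.2 + C * p.2 ^ 2).natAbs =
        if p = 0 then 0 else g p := by
    intro p
    by_cases hp : p = 0
    · subst hp
      simp [hf]
    · have hQ : 0 < bqfEval (A : ℝ) ((t - 2 * k : ℤ) : ℝ) (C : ℝ) p := hpos.eval_pos hp
      have hQeq : bqfEval (A : ℝ) ((t - 2 * k : ℤ) : ℝ) (C : ℝ) p =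
          ((A * p.1 ^ 2 + (t - 2 * k) * p.1 * p.2 + C * p.2 ^ 2 : ℤ) : ℝ) := by
        unfold bqfEval; push_cast; ring
      rw [hQeq] at hQ
      have hQ' : 0 < A * p.1 ^ 2 + (t - 2 * k) * p.1 * p.2 + C * p.2 ^ 2 := by exact_mod_cast hQ
      have hne : (A * p.1 ^ 2 + (t - 2 * k) * p.1 * p.2 + C * p.2 ^ 2).natAbs ≠ 0 :=
        Int.natAbs_ne_zero.mpr hQ'.ne'
      rw [if_neg hp, hf]
      simp only [hne, if_false, hg]
      congr 2
      rw [← Int.cast_natCast, Int.natAbs_of_nonneg hQ'.le]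
  have hfsum : Summable fun p : ℤ × ℤ =>
      f (A * p.1 ^ 2 + (t - 2 * k) * p.1 * p.2 + C * p.2 ^ 2).natAbs := by
    have hupd : (fun p : ℤ × ℤ => if p = 0 then 0 else g p) = Function.update g 0 0 := by
      funext p
      rw [Function.update_apply]
    have : Summable fun p : ℤ × ℤ => if p = 0 then 0 else g p := by
      rw [hupd]
      exact hgsum.update 0 0
    exact this.congr fun p => (hfg p).symm
  have hmain := hasSum_ideal_mul_isPrincipal_weight b hb hω hD hA hn hf0 hfsum
  -- the lattice sum: `Σ_p f(Q p) = Σ_p g(p) − g(0) = Σ_p g(p) − 1`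
  have htsum : (∑' p : ℤ × ℤ, f (A * p.1 ^ 2 + (t - 2 * k) * p.1 * p.2 + C * p.2 ^ 2).natAbs) =
      (∑' p : ℤ × ℤ, g p) - 1 := by
    rw [tsum_congr hfg, hgsum.tsum_eq_add_tsum_ite 0]
    have hg0 : g 0 = 1 := by simp [hg]
    rw [hg0]
    ring
  rw [htsum] at hmain
  -- the weight on ideals: `f(N J) = [J ≠ 0] e(τ N J)`
  have hJ : ∀ J : {J : Ideal (𝓞 K) // (span {(A : 𝓞 K), b 1 - k} * J).IsPrincipal},
      f (absNorm J.1) =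
        if (J.1 : Ideal (𝓞 K)) = ⊥ then 0 else cexp (2 * Real.pi * I * τ * (absNorm J.1 : ℂ)) := by
    intro J
    simp only [hf, Ideal.absNorm_eq_zero_iff]
  simp only [hJ] at hmain
  convert hmain using 1
  ring

end Literature.NumberTheory.QuadraticFields.Quadratic

end
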